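import Summits.QuantumFields.YangMills.Theorems.BalabanUVNodesPortS1Selector
import Summits.QuantumFields.YangMills.Theorems.BalabanUVNodesPortS1LocalFormula

/-!
# NODE O port PT-A — THE (S1) ASSEMBLY AT THE TWO-BLOCK ∕ CENTRED NAMES FROM ONE RESIDUE: all format bookkeeping of 27930's consequent discharged, what is
# left is print's content — ONE window-local, gauge-invariant integer formula family with analyticity and (1.18) on the record space ([I] §3–§5 + [II] + [16] (63))
# and the (1.6)–(1.7)∕(1.9) pair identity for the functional near `B = 0` ([I] §2), under the displayed [15] Prop. 9 token

Cell `ym-nodeO-ideate`, porter seat `ymgap-nodeO-port-PTA-1` (gen 2); `--supports stmt-QuantumFields-27930`; PORT-PLAN v1 §1 (the composition of the closing theorem).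
[I] = [Balaban1987RG1], [II] = [Balaban1988RG2Cluster], [15] = [Balaban1985Variational], [16] = [Balaban1985UV3].

WHAT.  ★★★ `formatPlusG_recordJ_of_intLocalResidue`: for ANY functional family `Φf n : recordW F a₀ ε₂₉ k (recordK₀ F Mc k + n) → ℂ` (the signed text's
`recordΦf F a₀ ε₂₉ k v (recordK₀ + n)`; after RC-1, `recordΦfAx … (FlowStep.prefixOf g k) …` — this theorem is agnostic), `B12FormatPlus.FormatPlusG` over the TWELVE record
families of 27930⁷∕⁸'s consequent (catalogue, coordinates, action, spaces `recordUc … α₀ α₁`, locality sets, `recordChartDimJ`, `recordChartJ`, `Φf`, `recordEmbJ`, and the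
centred two-volume layer `recordWrapCtr ∕ recordDomEmbCtr ∕ recordCoordProjCtr`) with constants `E₀, κ` FOLLOWS from:
* the TokP9-reg SHAPE at every volume (an ANTECEDENT of ⁸; CRIT-1 RULING (B)∕Q-4);
* ONE integer-local formula `Ψ` (window-local: reads only the integer bonds of `X̂`; invariant under the pulled-back (1.10) action of `SL(2, ℂ)`-valued integer gauge
  transformations) whose pull-back pieces `φ ↦ Ψ X̂_K(X) (φ ∘ cover_K)` are (a) analytic at every pair of the record space and (b) obey (1.18) there;
* (f′) the PAIR IDENTITY near `B = 0`: `Φf n B = Σ_X Ψ X̂(X) ((U_{k+1}(W_B), J(U_{k+1}(W_B))) cut to X, pulled back)`.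
Rows (c) locality, (d) (1.19), (e) two-volume identity are BY CONSTRUCTION (`…PortS1LocalFormula`), row (f) from (f′) + the token (`…PortS1Selector` §3), the frame by
`formatPlusG_record_of_cpairRowsCtr` (`…PortS1Frame`).  So the port's REMAINING CONTENT for 27930 is exactly the residue (a) + (b) + (f′) for a formula `Ψ` — print's
[I] §3–§5 ∕ [II] Lemmas 1–3 ∕ [16] (63) (the pieces and their analytic bounds) and [I] §2 (2.1)–(2.14) (the identity), at the record's (RC-1) functional.

HONEST FRAMING.  A reduction theorem (bookkeeping); the residue is NOT proved here and is NOT dressed as a fact; nothing of Bałaban's estimates asserted, ported or discharged;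
27930 OPEN; K0⁷ NOT closed; NODE O 0∕1; COUNT 8∕28 · K 1∕4 UNMOVED; finite `𝕋⁴_{L^K}` at fixed ε — NOT continuum ∕ OS ∕ Clay; **the Yang–Mills mass gap is NOT proved by any
of this.**  No `sorry`, no `def`, no `instance`; standard axioms.

v2 (same seat, APPEND-ONLY; §1 byte-identical to ✓p797604): §2 GAUGE FREEDOM of the residue's right-hand side — `sl2Proj_R`, ★ `piece_pairCut_cAct` (the cut piece is blind to (1.10)),
`pairOf_gaugeAct` (`(U^g, J(U^g)) = (U, J(U))^g` in `Sect2.CPair`): (f′) may be verified for ANY representative of the minimal orbit.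

v3 (same seat, APPEND-ONLY; §1–§2 byte-identical to ✓p797845): §3 ★★★ `formatPlusG_recordJ_of_intLocalResidue₂` — the same from TWO formulas `Ψ_LZ + Ψ_FE` with constants `E₁ + E₂`
(print's two halves of (1.18), [II] p.21).
-/

noncomputable section

open scoped BigOperators Matrix.Norms.L2Operator Topology

namespace Summit.QuantumFields.YangMills.Theorems.BalabanUVNodesPortS1

open Summit.QuantumFields.YangMills.Theorems.K0RecordFormatNames
open Literature.MathematicalPhysics.QuantumFieldTheory.Balaban1983to89
open Literature.MathematicalPhysics.QuantumFieldTheory.Balaban1983to89.Node00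
open Literature.MathematicalPhysics.QuantumFieldTheory.Balaban1983to89.T4Continuum (T4Family)
open Literature.MathematicalPhysics.QuantumFieldTheory.Balaban1983to89.B15Eq112TorusCover (cover)
open Literature.MathematicalPhysics.QuantumFieldTheory.Balaban1983to89.B14.Eq213MaximalDomains (cubeExt)
open NormedSpace (exp)
open _root_.Filter

variable (F : T4Family)

open scoped Classical in
/-- ★★★ **THE (S1) MOULD AT 27930's NAMES FROM ONE RESIDUE.**  Hypotheses: `hP9` — the TokP9-reg shape at every volume `recordK₀ + n`; `Ψ` with `hΨloc` (window-local) and `hΨG`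
(invariant under the pulled-back (1.10) action); (a) `hA` and (b) `hB` for the pull-back pieces on the record space `recordUc … α₀ α₁`; (f′) `hR` — the pair identity for `Φf n`
near `B = 0`.  Conclusion: `B12FormatPlus.FormatPlusG` over the twelve record families of the signed consequent (two-block chart∕embedding, centred two-volume layer) with
`E₀, κ`, for THIS `Φf`.  Composition of `formatPlusG_record_of_cpairRowsCtr` (frame), `local17_∕gaugeInv119_∕pieceVolIndep_cpair_of_intLocalFormula` (rows (c)(d)(e)) and
`eventually_repr_recordChartJ_of_pairIdentity_of_analyticAt` (row (f)). [cite: Balaban1987RG1, (1.6)–(1.9) p.261, (1.10) p.262, (1.18)–(1.19) p.263, (1.21) p.264; Balaban1985Variational, Prop. 9 p.309] -/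
theorem formatPlusG_recordJ_of_intLocalResidue (Mc k : ℕ) (hMc : McGuard F Mc) (a₀ ε₂₉ α₀ α₁ E₀ κ : ℝ)
    (Φf : (n : ℕ) → recordW F a₀ ε₂₉ k (recordK₀ F Mc k + n) → ℂ)
    (hP9 : ∀ n, letI θ := thetaFill F a₀ ε₂₉; letI := θ.instVβ₁; letI := θ.instVβ₂; letI := θ.instιβ
      AnalyticAt ℝ (fun B : recordW F a₀ ε₂₉ k (recordK₀ F Mc k + n) =>
        fun (b : PBond (F.P (recordK₀ F Mc k + n)) 0) (i i' : Fin 2) =>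
          ((recordBgField F θ k (recordK₀ F Mc k + n) B b : SU 2) : Matrix (Fin 2) (Fin 2) ℂ) i i') 0)
    (Ψ : Finset (Fin 4 → ℤ) → (((Fin 4 → ℤ) × Fin 4) → MatA 2 × MatA 2) → ℂ)
    (hΨloc : ∀ (Xh : Finset (Fin 4 → ℤ)) (f g : ((Fin 4 → ℤ) × Fin 4) → MatA 2 × MatA 2),
      (∀ zμ : (Fin 4 → ℤ) × Fin 4,
        zμ.1 ∈ (⋃ a ∈ Xh, cubeExt (F.L ^ (k + 1) * Mc) a 0) →
        Function.update zμ.1 zμ.2 (zμ.1 zμ.2 + 1) ∈ (⋃ a ∈ Xh, cubeExt (F.L ^ (k + 1) * Mc) a 0) → f zμ = g zμ) →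
      Ψ Xh f = Ψ Xh g)
    (hΨG : ∀ (Xh : Finset (Fin 4 → ℤ)) (û : (Fin 4 → ℤ) → (MatA 2)ˣ),
      (∀ z, û z ∈ (B12RegularSpaces111SpecialUnitary.suModel 2).Gc) →
      ∀ f : ((Fin 4 → ℤ) × Fin 4) → MatA 2 × MatA 2,
        Ψ Xh (fun zμ => ((û zμ.1 : MatA 2) * (f zμ).1 * ((û (Function.update zμ.1 zμ.2 (zμ.1 zμ.2 + 1)))⁻¹ : (MatA 2)ˣ),
          (û zμ.1 : MatA 2) * (f zμ).2 * ((û zμ.1)⁻¹ : (MatA 2)ˣ))) = Ψ Xh f)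
    (hA : ∀ n (X : (recordDomSys F Mc k (recordK₀ F Mc k + n)).Dom) (φ : Sect2.CPair (F.P (recordK₀ F Mc k + n)) (MatA 2)),
      encodeCfg F (recordK₀ F Mc k + n) φ ∈ recordUc F Mc k α₀ α₁ (recordK₀ F Mc k + n) X →
        AnalyticAt ℂ (fun ψ : Sect2.CPair (F.P (recordK₀ F Mc k + n)) (MatA 2) =>
          Ψ ((X.1 : Finset _).image (fun c (i : Fin 4) => (c i).valMinAbs))
            (fun zμ => (ψ.1 ⟨cover (F.P (recordK₀ F Mc k + n)) zμ.1, zμ.2⟩, ψ.2 ⟨cover (F.P (recordK₀ F Mc k + n)) zμ.1, zμ.2⟩))) φ)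
    (hB : ∀ n (X : (recordDomSys F Mc k (recordK₀ F Mc k + n)).Dom) (φ : Sect2.CPair (F.P (recordK₀ F Mc k + n)) (MatA 2)),
      encodeCfg F (recordK₀ F Mc k + n) φ ∈ recordUc F Mc k α₀ α₁ (recordK₀ F Mc k + n) X →
        ‖Ψ ((X.1 : Finset _).image (fun c (i : Fin 4) => (c i).valMinAbs))
            (fun zμ => (φ.1 ⟨cover (F.P (recordK₀ F Mc k + n)) zμ.1, zμ.2⟩, φ.2 ⟨cover (F.P (recordK₀ F Mc k + n)) zμ.1, zμ.2⟩))‖ ≤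
          E₀ * Real.exp (-κ * (recordDomSys F Mc k (recordK₀ F Mc k + n)).dj X))
    (hR : ∀ n, letI θ := thetaFill F a₀ ε₂₉; letI := θ.instVβ₁; letI := θ.instVβ₂; letI := θ.instιβ
      ∀ᶠ B in 𝓝 (0 : recordW F a₀ ε₂₉ k (recordK₀ F Mc k + n)),
        Φf n B = ∑ X : (recordDomSys F Mc k (recordK₀ F Mc k + n)).Dom,
          Ψ ((X.1 : Finset _).image (fun c (i : Fin 4) => (c i).valMinAbs))
            (fun zμ =>
              ((if (⟨cover (F.P (recordK₀ F Mc k + n)) zμ.1, zμ.2⟩ : PBond (F.P (recordK₀ F Mc k + n)) 0) ∈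
                    domBonds F Mc k (recordK₀ F Mc k + n) X then
                  ((recordBgField F θ k (recordK₀ F Mc k + n) B ⟨cover (F.P (recordK₀ F Mc k + n)) zμ.1, zμ.2⟩ : SU 2) : MatA 2) else 1),
               (if (⟨cover (F.P (recordK₀ F Mc k + n)) zμ.1, zμ.2⟩ : PBond (F.P (recordK₀ F Mc k + n)) 0) ∈
                    domBonds F Mc k (recordK₀ F Mc k + n) X then
                  recordCurrent F θ k (recordK₀ F Mc k + n) B ⟨cover (F.P (recordK₀ F Mc k + n)) zμ.1, zμ.2⟩ else 0)))) :
    letI θ := thetaFill F a₀ ε₂₉; letI := θ.instVβ₁; letI := θ.instVβ₂; letI := θ.instιβ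
    B12FormatPlus.FormatPlusG
      (fun n => recordDomSys F Mc k (recordK₀ F Mc k + n)) (fun n => recordBondCount F (recordK₀ F Mc k + n))
      (fun n => recordAct F (recordK₀ F Mc k + n)) (fun n => recordUc F Mc k α₀ α₁ (recordK₀ F Mc k + n))
      (fun n => recordCoords F Mc k (recordK₀ F Mc k + n)) (fun n => recordChartDimJ F (recordK₀ F Mc k + n))
      (fun n => recordChartJ F Mc k (recordK₀ F Mc k + n)) Φf
      (fun n => recordEmbJ F θ k (recordK₀ F Mc k + n))
      (fun n => recordWrapCtr F Mc k (recordK₀ F Mc k + n)) (fun n => recordDomEmbCtr F Mc k (recordK₀ F Mc k + n))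
      (fun n _ => recordCoordProjCtr F (recordK₀ F Mc k + n)) E₀ κ := by
  letI θ := thetaFill F a₀ ε₂₉; letI := θ.instVβ₁; letI := θ.instVβ₂; letI := θ.instιβ
  -- the pieces ON PAIRS: the pull-back of the formula
  refine formatPlusG_record_of_cpairRowsCtr F Mc k α₀ α₁ E₀ κ (recordK₀ F Mc k)
    (fun n => recordChartJ F Mc k (recordK₀ F Mc k + n)) Φf (fun n => recordEmbJ F θ k (recordK₀ F Mc k + n))
    (fun n X φ => Ψ ((X.1 : Finset _).image (fun c (i : Fin 4) => (c i).valMinAbs))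
      (fun zμ => (φ.1 ⟨cover (F.P (recordK₀ F Mc k + n)) zμ.1, zμ.2⟩, φ.2 ⟨cover (F.P (recordK₀ F Mc k + n)) zμ.1, zμ.2⟩)))
    hA hB (fun n => ?_) (fun n => ?_) ?_ (fun n => ?_)
  · -- (c) locality by construction
    exact local17_cpair_of_intLocalFormula hMc (Nat.le_add_right _ _) Ψ hΨloc _ (fun _ _ => rfl)
  · -- (d) (1.19) by construction
    exact gaugeInv119_cpair_of_intLocalFormula (Mc := Mc) (k := k) Ψ hΨG _ (fun _ _ => rfl)
  · -- (e) two-volume identity by construction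
    exact pieceVolIndep_cpair_of_intLocalFormula Mc k (recordK₀ F Mc k) hMc le_rfl Ψ hΨloc _ (fun _ _ _ => rfl)
  · -- (f) from (f′) + the token
    have h := eventually_repr_recordChartJ_of_pairIdentity_of_analyticAt F θ Mc (succ_le_m_add_K_recordK₀ F Mc k n) (hP9 n) (Φf n)
      (fun X φ => Ψ ((X.1 : Finset _).image (fun c (i : Fin 4) => (c i).valMinAbs))
        (fun zμ => (φ.1 ⟨cover (F.P (recordK₀ F Mc k + n)) zμ.1, zμ.2⟩, φ.2 ⟨cover (F.P (recordK₀ F Mc k + n)) zμ.1, zμ.2⟩)))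
      (by
        filter_upwards [hR n] with B hB'
        rw [hB'])
    exact h

/-! ## §2  (v2 APPEND) GAUGE FREEDOM OF THE RESIDUE's RIGHT-HAND SIDE: the sum of the pull-back pieces over print's (1.9) pair CUT TO `X` does not see the GAUGE of
the background — `(𝐔, 𝐉)` and `(𝐔, 𝐉)^u` give the same piece after the cut (locality (c) + (1.19) (d) by construction), and `(U^g, J(U^g)) = (U, J(U))^g` for `SU(2)`-valued `g`
(`B12Eq18Current.current_gaugeU`), so (f′) may be verified for ANY representative of the minimal orbit (print's axial∕Landau `U_{k+1}`), not only the rooted `recordBgField` -/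

/-- `sl2Proj` commutes with the adjoint action `R(v) X = v X v⁻¹` (trace invariance). [cite: Balaban1987RG1, (1.8) p.261, (1.10) p.262] -/
theorem sl2Proj_R (v : (MatA 2)ˣ) (X : MatA 2) : sl2Proj (B9Eq39Adjoint.R v X) = B9Eq39Adjoint.R v (sl2Proj X) := by
  rw [sl2Proj_apply, sl2Proj_apply, trace_R]
  simp only [B9Eq39Adjoint.R, mul_sub, sub_mul, Matrix.mul_smul, Matrix.smul_mul, mul_one, Units.mul_inv]

variable {F} in
open scoped Classical in
/-- **THE CUT PIECE IS BLIND TO (1.10)**: for a window-local, gauge-invariant integer formula `Ψ` (exactly the residue's `hΨloc`, `hΨG`) on the exactly tiled range, a `Gᶜ`-valued gauge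
transformation `u` of the fine torus and ANY pair `φ`, the pull-back piece of `X` at `(φ^u cut to X)` equals the piece at `(φ cut to X)` — the two cut pairs agree on the bonds of `X`
with `(φ cut to X)^u` (row (c)), which (d) then un-twists. [cite: Balaban1987RG1, (1.7) p.261, (1.10) p.262, (1.19) p.263] -/
theorem piece_pairCut_cAct {Mc k K : ℕ} (hMc : McGuard F Mc) (hK : recordK₀ F Mc k ≤ K)
    (Ψ : Finset (Fin 4 → ℤ) → (((Fin 4 → ℤ) × Fin 4) → MatA 2 × MatA 2) → ℂ)
    (hΨloc : ∀ (Xh : Finset (Fin 4 → ℤ)) (f g : ((Fin 4 → ℤ) × Fin 4) → MatA 2 × MatA 2),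
      (∀ zμ : (Fin 4 → ℤ) × Fin 4,
        zμ.1 ∈ (⋃ a ∈ Xh, cubeExt (F.L ^ (k + 1) * Mc) a 0) →
        Function.update zμ.1 zμ.2 (zμ.1 zμ.2 + 1) ∈ (⋃ a ∈ Xh, cubeExt (F.L ^ (k + 1) * Mc) a 0) → f zμ = g zμ) →
      Ψ Xh f = Ψ Xh g)
    (hΨG : ∀ (Xh : Finset (Fin 4 → ℤ)) (û : (Fin 4 → ℤ) → (MatA 2)ˣ),
      (∀ z, û z ∈ (B12RegularSpaces111SpecialUnitary.suModel 2).Gc) →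
      ∀ f : ((Fin 4 → ℤ) × Fin 4) → MatA 2 × MatA 2,
        Ψ Xh (fun zμ => ((û zμ.1 : MatA 2) * (f zμ).1 * ((û (Function.update zμ.1 zμ.2 (zμ.1 zμ.2 + 1)))⁻¹ : (MatA 2)ˣ),
          (û zμ.1 : MatA 2) * (f zμ).2 * ((û zμ.1)⁻¹ : (MatA 2)ˣ))) = Ψ Xh f)
    (X : (recordDomSys F Mc k K).Dom) (u : recordGaugeGrp F K) (φ : Sect2.CPair (F.P K) (MatA 2)) :
    Ψ ((X.1 : Finset _).image (fun c (i : Fin 4) => (c i).valMinAbs))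
        (fun zμ => ((if (⟨cover (F.P K) zμ.1, zμ.2⟩ : PBond (F.P K) 0) ∈ domBonds F Mc k K X then (Sect2.cAct u.1 φ).1 ⟨cover (F.P K) zμ.1, zμ.2⟩ else 1),
                    (if (⟨cover (F.P K) zμ.1, zμ.2⟩ : PBond (F.P K) 0) ∈ domBonds F Mc k K X then (Sect2.cAct u.1 φ).2 ⟨cover (F.P K) zμ.1, zμ.2⟩ else 0))) =
      Ψ ((X.1 : Finset _).image (fun c (i : Fin 4) => (c i).valMinAbs))
        (fun zμ => ((if (⟨cover (F.P K) zμ.1, zμ.2⟩ : PBond (F.P K) 0) ∈ domBonds F Mc k K X then φ.1 ⟨cover (F.P K) zμ.1, zμ.2⟩ else 1),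
                    (if (⟨cover (F.P K) zμ.1, zμ.2⟩ : PBond (F.P K) 0) ∈ domBonds F Mc k K X then φ.2 ⟨cover (F.P K) zμ.1, zμ.2⟩ else 0))) := by
  -- the pull-back pieces as a function of pairs
  have hL := local17_cpair_of_intLocalFormula hMc hK Ψ hΨloc
    (fun X ψ => Ψ ((X.1 : Finset _).image (fun c (i : Fin 4) => (c i).valMinAbs))
      (fun zμ => (ψ.1 ⟨cover (F.P K) zμ.1, zμ.2⟩, ψ.2 ⟨cover (F.P K) zμ.1, zμ.2⟩))) (fun _ _ => rfl)
  have hG := gaugeInv119_cpair_of_intLocalFormula (Mc := Mc) (k := k) (K := K) Ψ hΨG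
    (fun X ψ => Ψ ((X.1 : Finset _).image (fun c (i : Fin 4) => (c i).valMinAbs))
      (fun zμ => (ψ.1 ⟨cover (F.P K) zμ.1, zμ.2⟩, ψ.2 ⟨cover (F.P K) zμ.1, zμ.2⟩))) (fun _ _ => rfl)
  -- the cut of `φ^u` agrees on `X` with `(cut of φ)^u`
  have step1 := hL X
    (fun b => if b ∈ domBonds F Mc k K X then (Sect2.cAct u.1 φ).1 b else 1,
     fun b => if b ∈ domBonds F Mc k K X then (Sect2.cAct u.1 φ).2 b else 0)
    (Sect2.cAct u.1 (fun b => if b ∈ domBonds F Mc k K X then φ.1 b else 1, fun b => if b ∈ domBonds F Mc k K X then φ.2 b else 0))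
    (fun b hs ht => by
      have hb : b ∈ domBonds F Mc k K X := ⟨hs, ht⟩
      simp only [Sect2.cAct, if_pos hb, and_self])
  have step2 := hG X u (fun b => if b ∈ domBonds F Mc k K X then φ.1 b else 1, fun b => if b ∈ domBonds F Mc k K X then φ.2 b else 0)
  exact step1.trans step2

/-- **`(U^g, J(U^g)) = (U, J(U))^g` read in `Sect2.CPair`** for an `SU(2)`-valued gauge transformation `g` (through `ιSU`) and the `sl2Proj`-current (1.8): the (1.9) pair of the
transformed background IS the (1.10)-transform of the (1.9) pair. [cite: Balaban1987RG1, (1.8)–(1.10) pp.261–262] -/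
theorem pairOf_gaugeAct (K : ℕ) (ξ : ℝ) (g : GaugeTransf (F.P K) 0 (SU 2)) (U : GaugeField (F.P K) 0 (SU 2)) :
    ((fun b => (((GaugeField.gaugeAct g U) b : SU 2) : MatA 2)),
      B12Eq18Current.current sl2Proj ξ (fun b => ιSU 2 ((GaugeField.gaugeAct g U) b))) =
    Sect2.cAct (fun x => ιSU 2 (g x))
      ((fun b => ((U b : SU 2) : MatA 2)), B12Eq18Current.current sl2Proj ξ (fun b => ιSU 2 (U b))) := by
  have hgU : (fun b => ιSU 2 ((GaugeField.gaugeAct g U) b)) = B12RegularSpaces111.gaugeU (fun x => ιSU 2 (g x)) (fun b => ιSU 2 (U b)) := by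
    funext b
    simp only [GaugeField.gaugeAct, B12RegularSpaces111.gaugeU, map_mul, map_inv]
  refine Prod.ext (funext fun b => ?_) (funext fun b => ?_)
  · show (((GaugeField.gaugeAct g U) b : SU 2) : MatA 2) = (ιSU 2 (g b.src) : MatA 2) * ((U b : SU 2) : MatA 2) * ((ιSU 2 (g b.tgt))⁻¹ : (MatA 2)ˣ)
    simp only [GaugeField.gaugeAct, coe_ιSU, ← map_inv]
    push_cast
    rfl
  · show B12Eq18Current.current sl2Proj ξ (fun b => ιSU 2 ((GaugeField.gaugeAct g U) b)) b =
      (ιSU 2 (g b.src) : MatA 2) * B12Eq18Current.current sl2Proj ξ (fun b => ιSU 2 (U b)) b * ((ιSU 2 (g b.src))⁻¹ : (MatA 2)ˣ)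
    rw [hgU, B12Eq18Current.current_gaugeU sl2Proj ξ _ (fun x X => sl2Proj_R _ X)]
    rfl

/-! ## §3  (v3 APPEND) THE SAME FROM TWO FORMULAS `Ψ_LZ + Ψ_FE` WITH CONSTANTS `E₁ + E₂` — print's structure ([I] p.261 L22–24: the [16] (63) pieces of `log Z^{(k)}`;
[II] p.21: «We define ½E₀ as equal to this constant» — the two halves of (1.18)) -/

open scoped Classical in
/-- ★★★ **THE (S1) MOULD AT 27930's NAMES FROM TWO RESIDUE FORMULAS.**  As `formatPlusG_recordJ_of_intLocalResidue`, with two window-local gauge-invariant integer formulas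
`Ψ₁` (pieces of `log Z^{(k)}`, [16] (63)) and `Ψ₂` (pieces of `E^{(k+1)}`, [II]) carrying rows (a)(b) with constants `E₁`, `E₂`, and (f′) the pair identity for `Φf n` with the
SUM of the two pull-back pieces; conclusion with constant `E₁ + E₂`. [cite: Balaban1987RG1, (1.6)–(1.9) p.261 (with p.261 L22–24), (1.18)–(1.19) p.263; Balaban1988RG2Cluster, p.21] -/
theorem formatPlusG_recordJ_of_intLocalResidue₂ (Mc k : ℕ) (hMc : McGuard F Mc) (a₀ ε₂₉ α₀ α₁ E₁ E₂ κ : ℝ)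
    (Φf : (n : ℕ) → recordW F a₀ ε₂₉ k (recordK₀ F Mc k + n) → ℂ)
    (hP9 : ∀ n, letI θ := thetaFill F a₀ ε₂₉; letI := θ.instVβ₁; letI := θ.instVβ₂; letI := θ.instιβ
      AnalyticAt ℝ (fun B : recordW F a₀ ε₂₉ k (recordK₀ F Mc k + n) =>
        fun (b : PBond (F.P (recordK₀ F Mc k + n)) 0) (i i' : Fin 2) =>
          ((recordBgField F θ k (recordK₀ F Mc k + n) B b : SU 2) : Matrix (Fin 2) (Fin 2) ℂ) i i') 0)
    (Ψ₁ Ψ₂ : Finset (Fin 4 → ℤ) → (((Fin 4 → ℤ) × Fin 4) → MatA 2 × MatA 2) → ℂ)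
    (hΨloc₁ : ∀ (Xh : Finset (Fin 4 → ℤ)) (f g : ((Fin 4 → ℤ) × Fin 4) → MatA 2 × MatA 2),
      (∀ zμ : (Fin 4 → ℤ) × Fin 4,
        zμ.1 ∈ (⋃ a ∈ Xh, cubeExt (F.L ^ (k + 1) * Mc) a 0) →
        Function.update zμ.1 zμ.2 (zμ.1 zμ.2 + 1) ∈ (⋃ a ∈ Xh, cubeExt (F.L ^ (k + 1) * Mc) a 0) → f zμ = g zμ) →
      Ψ₁ Xh f = Ψ₁ Xh g)
    (hΨG₁ : ∀ (Xh : Finset (Fin 4 → ℤ)) (û : (Fin 4 → ℤ) → (MatA 2)ˣ),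
      (∀ z, û z ∈ (B12RegularSpaces111SpecialUnitary.suModel 2).Gc) →
      ∀ f : ((Fin 4 → ℤ) × Fin 4) → MatA 2 × MatA 2,
        Ψ₁ Xh (fun zμ => ((û zμ.1 : MatA 2) * (f zμ).1 * ((û (Function.update zμ.1 zμ.2 (zμ.1 zμ.2 + 1)))⁻¹ : (MatA 2)ˣ),
          (û zμ.1 : MatA 2) * (f zμ).2 * ((û zμ.1)⁻¹ : (MatA 2)ˣ))) = Ψ₁ Xh f)
    (hA₁ : ∀ n (X : (recordDomSys F Mc k (recordK₀ F Mc k + n)).Dom) (φ : Sect2.CPair (F.P (recordK₀ F Mc k + n)) (MatA 2)),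
      encodeCfg F (recordK₀ F Mc k + n) φ ∈ recordUc F Mc k α₀ α₁ (recordK₀ F Mc k + n) X →
        AnalyticAt ℂ (fun ψ : Sect2.CPair (F.P (recordK₀ F Mc k + n)) (MatA 2) =>
          Ψ₁ ((X.1 : Finset _).image (fun c (i : Fin 4) => (c i).valMinAbs))
            (fun zμ => (ψ.1 ⟨cover (F.P (recordK₀ F Mc k + n)) zμ.1, zμ.2⟩, ψ.2 ⟨cover (F.P (recordK₀ F Mc k + n)) zμ.1, zμ.2⟩))) φ)
    (hB₁ : ∀ n (X : (recordDomSys F Mc k (recordK₀ F Mc k + n)).Dom) (φ : Sect2.CPair (F.P (recordK₀ F Mc k + n)) (MatA 2)),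
      encodeCfg F (recordK₀ F Mc k + n) φ ∈ recordUc F Mc k α₀ α₁ (recordK₀ F Mc k + n) X →
        ‖Ψ₁ ((X.1 : Finset _).image (fun c (i : Fin 4) => (c i).valMinAbs))
            (fun zμ => (φ.1 ⟨cover (F.P (recordK₀ F Mc k + n)) zμ.1, zμ.2⟩, φ.2 ⟨cover (F.P (recordK₀ F Mc k + n)) zμ.1, zμ.2⟩))‖ ≤
          E₁ * Real.exp (-κ * (recordDomSys F Mc k (recordK₀ F Mc k + n)).dj X))
    (hΨloc₂ : ∀ (Xh : Finset (Fin 4 → ℤ)) (f g : ((Fin 4 → ℤ) × Fin 4) → MatA 2 × MatA 2),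
      (∀ zμ : (Fin 4 → ℤ) × Fin 4,
        zμ.1 ∈ (⋃ a ∈ Xh, cubeExt (F.L ^ (k + 1) * Mc) a 0) →
        Function.update zμ.1 zμ.2 (zμ.1 zμ.2 + 1) ∈ (⋃ a ∈ Xh, cubeExt (F.L ^ (k + 1) * Mc) a 0) → f zμ = g zμ) →
      Ψ₂ Xh f = Ψ₂ Xh g)
    (hΨG₂ : ∀ (Xh : Finset (Fin 4 → ℤ)) (û : (Fin 4 → ℤ) → (MatA 2)ˣ),
      (∀ z, û z ∈ (B12RegularSpaces111SpecialUnitary.suModel 2).Gc) →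
      ∀ f : ((Fin 4 → ℤ) × Fin 4) → MatA 2 × MatA 2,
        Ψ₂ Xh (fun zμ => ((û zμ.1 : MatA 2) * (f zμ).1 * ((û (Function.update zμ.1 zμ.2 (zμ.1 zμ.2 + 1)))⁻¹ : (MatA 2)ˣ),
          (û zμ.1 : MatA 2) * (f zμ).2 * ((û zμ.1)⁻¹ : (MatA 2)ˣ))) = Ψ₂ Xh f)
    (hA₂ : ∀ n (X : (recordDomSys F Mc k (recordK₀ F Mc k + n)).Dom) (φ : Sect2.CPair (F.P (recordK₀ F Mc k + n)) (MatA 2)),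
      encodeCfg F (recordK₀ F Mc k + n) φ ∈ recordUc F Mc k α₀ α₁ (recordK₀ F Mc k + n) X →
        AnalyticAt ℂ (fun ψ : Sect2.CPair (F.P (recordK₀ F Mc k + n)) (MatA 2) =>
          Ψ₂ ((X.1 : Finset _).image (fun c (i : Fin 4) => (c i).valMinAbs))
            (fun zμ => (ψ.1 ⟨cover (F.P (recordK₀ F Mc k + n)) zμ.1, zμ.2⟩, ψ.2 ⟨cover (F.P (recordK₀ F Mc k + n)) zμ.1, zμ.2⟩))) φ)
    (hB₂ : ∀ n (X : (recordDomSys F Mc k (recordK₀ F Mc k + n)).Dom) (φ : Sect2.CPair (F.P (recordK₀ F Mc k + n)) (MatA 2)),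
      encodeCfg F (recordK₀ F Mc k + n) φ ∈ recordUc F Mc k α₀ α₁ (recordK₀ F Mc k + n) X →
        ‖Ψ₂ ((X.1 : Finset _).image (fun c (i : Fin 4) => (c i).valMinAbs))
            (fun zμ => (φ.1 ⟨cover (F.P (recordK₀ F Mc k + n)) zμ.1, zμ.2⟩, φ.2 ⟨cover (F.P (recordK₀ F Mc k + n)) zμ.1, zμ.2⟩))‖ ≤
          E₂ * Real.exp (-κ * (recordDomSys F Mc k (recordK₀ F Mc k + n)).dj X))
    (hR : ∀ n, letI θ := thetaFill F a₀ ε₂₉; letI := θ.instVβ₁; letI := θ.instVβ₂; letI := θ.instιβ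
      ∀ᶠ B in 𝓝 (0 : recordW F a₀ ε₂₉ k (recordK₀ F Mc k + n)),
        Φf n B = ∑ X : (recordDomSys F Mc k (recordK₀ F Mc k + n)).Dom,
          (Ψ₁ ((X.1 : Finset _).image (fun c (i : Fin 4) => (c i).valMinAbs))
            (fun zμ =>
              ((if (⟨cover (F.P (recordK₀ F Mc k + n)) zμ.1, zμ.2⟩ : PBond (F.P (recordK₀ F Mc k + n)) 0) ∈ domBonds F Mc k (recordK₀ F Mc k + n) X then
                  ((recordBgField F θ k (recordK₀ F Mc k + n) B ⟨cover (F.P (recordK₀ F Mc k + n)) zμ.1, zμ.2⟩ : SU 2) : MatA 2) else 1),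
               (if (⟨cover (F.P (recordK₀ F Mc k + n)) zμ.1, zμ.2⟩ : PBond (F.P (recordK₀ F Mc k + n)) 0) ∈ domBonds F Mc k (recordK₀ F Mc k + n) X then
                  recordCurrent F θ k (recordK₀ F Mc k + n) B ⟨cover (F.P (recordK₀ F Mc k + n)) zμ.1, zμ.2⟩ else 0))) +
           Ψ₂ ((X.1 : Finset _).image (fun c (i : Fin 4) => (c i).valMinAbs))
            (fun zμ =>
              ((if (⟨cover (F.P (recordK₀ F Mc k + n)) zμ.1, zμ.2⟩ : PBond (F.P (recordK₀ F Mc k + n)) 0) ∈ domBonds F Mc k (recordK₀ F Mc k + n) X then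
                  ((recordBgField F θ k (recordK₀ F Mc k + n) B ⟨cover (F.P (recordK₀ F Mc k + n)) zμ.1, zμ.2⟩ : SU 2) : MatA 2) else 1),
               (if (⟨cover (F.P (recordK₀ F Mc k + n)) zμ.1, zμ.2⟩ : PBond (F.P (recordK₀ F Mc k + n)) 0) ∈ domBonds F Mc k (recordK₀ F Mc k + n) X then
                  recordCurrent F θ k (recordK₀ F Mc k + n) B ⟨cover (F.P (recordK₀ F Mc k + n)) zμ.1, zμ.2⟩ else 0))))) :
    letI θ := thetaFill F a₀ ε₂₉; letI := θ.instVβ₁; letI := θ.instVβ₂; letI := θ.instιβ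
    B12FormatPlus.FormatPlusG
      (fun n => recordDomSys F Mc k (recordK₀ F Mc k + n)) (fun n => recordBondCount F (recordK₀ F Mc k + n))
      (fun n => recordAct F (recordK₀ F Mc k + n)) (fun n => recordUc F Mc k α₀ α₁ (recordK₀ F Mc k + n))
      (fun n => recordCoords F Mc k (recordK₀ F Mc k + n)) (fun n => recordChartDimJ F (recordK₀ F Mc k + n))
      (fun n => recordChartJ F Mc k (recordK₀ F Mc k + n)) Φf
      (fun n => recordEmbJ F θ k (recordK₀ F Mc k + n))
      (fun n => recordWrapCtr F Mc k (recordK₀ F Mc k + n)) (fun n => recordDomEmbCtr F Mc k (recordK₀ F Mc k + n))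
      (fun n _ => recordCoordProjCtr F (recordK₀ F Mc k + n)) (E₁ + E₂) κ := by
  refine formatPlusG_recordJ_of_intLocalResidue F Mc k hMc a₀ ε₂₉ α₀ α₁ (E₁ + E₂) κ Φf hP9 (fun Xh f => Ψ₁ Xh f + Ψ₂ Xh f)
    (fun Xh f g hfg => by rw [hΨloc₁ Xh f g hfg, hΨloc₂ Xh f g hfg])
    (fun Xh û hû f => by rw [hΨG₁ Xh û hû f, hΨG₂ Xh û hû f])
    (fun n X φ hφ => (hA₁ n X φ hφ).add (hA₂ n X φ hφ))
    (fun n X φ hφ => ?_) (fun n => ?_)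
  · calc ‖Ψ₁ _ _ + Ψ₂ _ _‖ ≤ ‖Ψ₁ _ _‖ + ‖Ψ₂ _ _‖ := norm_add_le _ _
      _ ≤ E₁ * Real.exp (-κ * (recordDomSys F Mc k (recordK₀ F Mc k + n)).dj X) + E₂ * Real.exp (-κ * (recordDomSys F Mc k (recordK₀ F Mc k + n)).dj X) :=
          add_le_add (hB₁ n X φ hφ) (hB₂ n X φ hφ)
      _ = (E₁ + E₂) * Real.exp (-κ * (recordDomSys F Mc k (recordK₀ F Mc k + n)).dj X) := by ring
  · exact hR n

end Summit.QuantumFields.YangMills.Theorems.BalabanUVNodesPortS1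

end
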